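import Literature.AnabelianGeometry.AbsoluteAnabelian.AbsTopIII.CcnSynchronizationModel
import Literature.Algebra.Module.PadicProductEndomorphisms
import HarnessLib

/-!
# [AbsTopIII] Prop. 1.4 (ii): the synchronization `I_x → M_X` is bijective once `d` is and `I_x ≅ Ẑ`

Mochizuki, *Topics in Absolute Anabelian Geometry III*, §1, Prop. 1.4 (ii) pp. 31–32 (lit key
`paper:url-5493eb38cbb7`), verbatim: "applying the differential of the “`E_2`-term” of the Leray
spectral sequence associated to this group extension to the element `1 ∈ Ẑ = Hom(I_x, I_x) =
H^0(Δ_X, H^1(I_x, I_x))` yields an element `∈ H^2(Δ_X, H^0(I_x, I_x)) = Hom(M_X, I_x)` [...]; this last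
element corresponds to the natural isomorphism `M_X ⥲ I_x` [relative to the well-known natural
identifications of `I_x`, `M_X` with `Ẑ(1)` [...]]" (p. 31 l. 47–56, p. 32 l. 1–2).

`CcnTransgression.lean` / `CcnSynchronization.lean` construct the differential `d` and the natural
synchronization `sync : Ker(Δ^{c-cn}_{U_x} ↠ Δ_X) → M_X = Hom_ℤ(H²(Δ_X, Ẑ), Ẑ)`, `i ↦ (ξ ↦ (d⁻¹ ξ)(i))`, and
leave "d is an isomorphism" as the named fact `Prop_1_4_ii_transgression`.  This file PROVES the
remaining step of the text's identification: **if `d` is bijective and the kernel is topologically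
isomorphic to `Ẑ` (the content of "`I_x ≅ Ẑ(1)`"), then `sync` is bijective** — because continuous
homomorphisms `Ẑ → Ẑ` and, more generally, all additive endomorphisms of `Ẑ` are multiplications
(`PadicProductEndomorphisms.lean`), so `M_X = Hom_ℤ(H², Ẑ) ≅ Hom_ℤ(Hom_cont(Ker, Ẑ), Ẑ) ≅ Ker`.

* `ZHatCoeff.addMonoidHom_apply_eq_mul` — additive endomorphisms of `Ẑ = ZHatCoeff` are `x ↦ x f(1)`;
* `synchronizationOfBijective_bijective` — the theorem above;
* `inertiaToExtKer_bijective` (from `IsCuspidallyCentralExtension`) and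
  `inertiaSynchronization_bijective` — hence `I_x → M_X` is bijective under
  `IsCuspidallyCentralExtension q I_x`, `d` bijective and `I_x ≃ₜ+ Ẑ`.

HONEST FRAMING: elementary; the inputs "d bijective" (Poincaré duality for `Δ_X`) and "`I_x ≅ Ẑ`" stay
hypotheses; nothing here bears on [IUTchIII] Cor. 3.12.
-/

noncomputable section

open CategoryTheory

universe u

namespace Literature.AnabelianGeometry.AbsoluteAnabelian.AbsTopIII

/-! ### Additive endomorphisms of `Ẑ = ZHatCoeff` -/

/-- Every additive endomorphism of `Ẑ` (`ZHatCoeff = ULift (∏_p ℤ_p)`) is `x ↦ x · f(1)`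
(transport of `PadicProductEnd.addMonoidHom_pi_apply_eq_mul`).
[cite: MochizukiAbsTopIII2015, Prop 1.4 (ii) p.32] -/
theorem ZHatCoeff.addMonoidHom_apply_eq_mul (f : ZHatCoeff.{u} →+ ZHatCoeff.{u}) (x : ZHatCoeff.{u}) :
    f x = x * f 1 := by
  let g : Literature.Algebra.Module.PadicProductEnd.PiZp →+
      Literature.Algebra.Module.PadicProductEnd.PiZp :=
    (AddEquiv.ulift (α := Literature.Algebra.Module.PadicProductEnd.PiZp)).toAddMonoidHom.comp
      (f.comp (AddEquiv.ulift (α := Literature.Algebra.Module.PadicProductEnd.PiZp)).symm.toAddMonoidHom)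
  have hg := Literature.Algebra.Module.PadicProductEnd.addMonoidHom_pi_apply_eq_mul g (AddEquiv.ulift x)
  apply (AddEquiv.ulift (α := Literature.Algebra.Module.PadicProductEnd.PiZp)).injective
  have h1 : (AddEquiv.ulift (α := Literature.Algebra.Module.PadicProductEnd.PiZp)).symm
      (AddEquiv.ulift x) = x := AddEquiv.symm_apply_apply _ _
  have h2 : (AddEquiv.ulift (α := Literature.Algebra.Module.PadicProductEnd.PiZp)).symm 1 =
      (1 : ZHatCoeff.{u}) := rfl
  simp only [g, AddMonoidHom.coe_comp, AddEquiv.coe_toAddMonoidHom, Function.comp_apply, h1,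
    h2] at hg
  rw [hg]
  rfl

/-- Right multiplication by `c` as a continuous additive endomorphism of `Ẑ`.
[cite: MochizukiAbsTopIII2015, Prop 1.4 (ii) p.32] -/
def ZHatCoeff.mulRightₜ (c : ZHatCoeff.{u}) : ZHatCoeff.{u} →ₜ+ ZHatCoeff.{u} where
  toAddMonoidHom := AddMonoidHom.mulRight c
  continuous_toFun := continuous_id.mul continuous_const

/-- Value of `mulRightₜ`. [cite: MochizukiAbsTopIII2015, Prop 1.4 (ii) p.32] -/
@[simp] theorem ZHatCoeff.mulRightₜ_apply (c x : ZHatCoeff.{u}) : ZHatCoeff.mulRightₜ c x = x * c := rfl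

variable {E F : FundamentalExtension.{u}} (q : E ⟶ F)

/-- A topological isomorphism `Ker ≅ Ẑ` as a continuous additive homomorphism.
[cite: MochizukiAbsTopIII2015, Prop 1.4 (ii) p.32] -/
def kerToZHat (e : Additive (ContinuousCohomology.extKer (deltaCcnProjₜ q)) ≃ₜ+ ZHatCoeff.{u}) :
    Additive (ContinuousCohomology.extKer (deltaCcnProjₜ q)) →ₜ+ ZHatCoeff.{u} where
  toAddMonoidHom := e.toAddEquiv.toAddMonoidHom
  continuous_toFun := e.continuous

/-- Value of `kerToZHat`. [cite: MochizukiAbsTopIII2015, Prop 1.4 (ii) p.32] -/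
@[simp] theorem kerToZHat_apply (e : Additive (ContinuousCohomology.extKer (deltaCcnProjₜ q)) ≃ₜ+ ZHatCoeff.{u})
    (i : Additive (ContinuousCohomology.extKer (deltaCcnProjₜ q))) : kerToZHat q e i = e i := rfl

/-- Every continuous homomorphism `Ker → Ẑ` is `i ↦ e(i) · χ(e⁻¹ 1)` for a topological isomorphism
`e : Ker ≅ Ẑ`. [cite: MochizukiAbsTopIII2015, Prop 1.4 (ii) p.32] -/
theorem contHom_apply_eq (e : Additive (ContinuousCohomology.extKer (deltaCcnProjₜ q)) ≃ₜ+ ZHatCoeff.{u})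
    (χ : Additive (ContinuousCohomology.extKer (deltaCcnProjₜ q)) →ₜ+ ZHatCoeff.{u})
    (i : Additive (ContinuousCohomology.extKer (deltaCcnProjₜ q))) :
    χ i = e i * χ (e.symm 1) := by
  have h := ZHatCoeff.addMonoidHom_apply_eq_mul
    (χ.toAddMonoidHom.comp e.symm.toAddEquiv.toAddMonoidHom) (e i)
  simp only [AddMonoidHom.coe_comp, AddEquiv.coe_toAddMonoidHom, Function.comp_apply,
    ContinuousAddMonoidHom.coe_toAddMonoidHom] at h
  have h1 : e.symm.toAddEquiv (e i) = i := e.symm_apply_apply i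
  rw [h1] at h
  exact h

/-- **If the differential `d` is bijective and `Ker(Δ^{c-cn}_{U_x} ↠ Δ_X) ≅ Ẑ` topologically, the
natural synchronization `Ker → M_X = Hom_ℤ(H²(Δ_X, Ẑ), Ẑ)` is BIJECTIVE** (Prop. 1.4 (ii): "this
last element corresponds to the natural isomorphism `M_X ⥲ I_x`").  PROVED.
[cite: MochizukiAbsTopIII2015, Prop 1.4 (ii) p.32] -/
theorem synchronizationOfBijective_bijective (s : CcnSection q)
    (hd : Function.Bijective (ccnTransgression q ZHatCoeff.{u} s))
    (e : Additive (ContinuousCohomology.extKer (deltaCcnProjₜ q)) ≃ₜ+ ZHatCoeff.{u}) :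
    Function.Bijective (synchronizationOfBijective q s hd) := by
  constructor
  · rw [injective_iff_map_eq_zero]
    intro i hi
    have h := congrArg (fun m : geomCyclotomeDual F ZHatCoeff.{u} =>
      m (ccnTransgression q ZHatCoeff.{u} s (kerToZHat q e))) hi
    simp only [synchronizationOfBijective_apply_transgression, kerToZHat_apply,
      LinearMap.zero_apply] at h
    apply e.injective
    rw [h]
    exact (AddEquiv.map_zero e.toAddEquiv).symm
  · intro m
    -- the additive map `c ↦ m (d (x ↦ e(x) c))`
    let χc : ZHatCoeff.{u} → (Additive (ContinuousCohomology.extKer (deltaCcnProjₜ q)) →ₜ+ ZHatCoeff.{u}) :=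
      fun c => (ZHatCoeff.mulRightₜ c).comp (kerToZHat q e)
    have hχc : ∀ c i, χc c i = e i * c := fun c i => rfl
    let F : ZHatCoeff.{u} →+ ZHatCoeff.{u} :=
      { toFun := fun c => m (ccnTransgression q ZHatCoeff.{u} s (χc c))
        map_zero' := by
          have h0 : χc 0 = 0 := ContinuousAddMonoidHom.ext fun i => by
            rw [hχc, mul_zero]; rfl
          rw [h0, map_zero, map_zero]
        map_add' := fun c c' => by
          have hadd : χc (c + c') = χc c + χc c' := ContinuousAddMonoidHom.ext fun i => by
            change e i * (c + c') = e i * c + e i * c'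
            rw [mul_add]
          rw [hadd, map_add, map_add] }
    refine ⟨e.symm (F 1), ?_⟩
    apply LinearMap.ext
    intro ξ
    rw [synchronizationOfBijective_apply]
    set χ := (AddEquiv.ofBijective _ hd).symm ξ with hχdef
    have hξ : ξ = ccnTransgression q ZHatCoeff.{u} s χ := by
      rw [hχdef]
      exact ((AddEquiv.ofBijective _ hd).apply_symm_apply ξ).symm
    have hχ' : χ = χc (χ (e.symm 1)) :=
      ContinuousAddMonoidHom.ext fun i => by rw [hχc]; exact contHom_apply_eq q e χ i
    have hF : F (χ (e.symm 1)) = χ (e.symm 1) * F 1 := ZHatCoeff.addMonoidHom_apply_eq_mul F _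
    calc χ (e.symm (F 1)) = e (e.symm (F 1)) * χ (e.symm 1) := contHom_apply_eq q e χ _
      _ = F 1 * χ (e.symm 1) := by rw [ContinuousAddEquiv.apply_symm_apply]
      _ = χ (e.symm 1) * F 1 := mul_comm _ _
      _ = F (χ (e.symm 1)) := hF.symm
      _ = m (ccnTransgression q ZHatCoeff.{u} s (χc (χ (e.symm 1)))) := rfl
      _ = m ξ := by rw [← hχ', ← hξ]

/-! ### From `I_x`: bijectivity of `I_x → Ker` and of the synchronization on `I_x` -/

variable {q} {I : Subgroup E.arith}

/-- Under `IsCuspidallyCentralExtension q I_x`, `I_x → Ker(Δ^{c-cn}_{U_x} ↠ Δ_X)` is bijective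
(`inertiaEquivGeomCyclotome` plus `Ker = M_X`). [cite: MochizukiAbsTopIII2015, Prop 1.4 (ii) p.31] -/
theorem inertiaToExtKer_bijective (h : IsCuspidallyCentralExtension q I) :
    Function.Bijective (inertiaToExtKer h.le_cuspidalKernel) := by
  have hb := inertiaToGeomCyclotome_bijective h
  constructor
  · intro i j hij
    apply hb.1
    apply Subtype.ext
    have := congrArg (fun y : ContinuousCohomology.extKer (deltaCcnProjₜ q) =>
      ((y : DeltaCcn q) : CuspidallyCentralQuotient q)) hij
    simpa using this
  · rintro ⟨⟨y, hy⟩, hyk⟩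
    have hyk' : y ∈ geomCyclotome q := by
      rw [extKer_deltaCcnProjₜ, Subgroup.mem_subgroupOf] at hyk
      exact hyk
    obtain ⟨i, hi⟩ := hb.2 ⟨y, hyk'⟩
    refine ⟨i, Subtype.ext (Subtype.ext ?_)⟩
    have := congrArg (fun z : geomCyclotome q => (z : CuspidallyCentralQuotient q)) hi
    simpa using this

/-- **The synchronization `I_x → M_X` is BIJECTIVE** under `IsCuspidallyCentralExtension q I_x`, `d`
bijective and a topological isomorphism `Ker ≅ Ẑ` — the conclusion "natural isomorphisms
`I_z ⥲ M_Z`" of Thm. 1.9 (b) for a cyclotome presentation, PROVED modulo those inputs.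
[cite: MochizukiAbsTopIII2015, Thm 1.9 (b) p.37] -/
theorem inertiaSynchronization_bijective (h : IsCuspidallyCentralExtension q I) (s : CcnSection q)
    (hd : Function.Bijective (ccnTransgression q ZHatCoeff.{u} s))
    (e : Additive (ContinuousCohomology.extKer (deltaCcnProjₜ q)) ≃ₜ+ ZHatCoeff.{u}) :
    Function.Bijective (inertiaSynchronization q h.le_cuspidalKernel s hd) := by
  unfold inertiaSynchronization
  exact (synchronizationOfBijective_bijective q s hd e).comp
    (by
      change Function.Bijective (fun i => MonoidHom.toAdditive (inertiaToExtKer h.le_cuspidalKernel) i)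
      exact (inertiaToExtKer_bijective h))

/-! ### Transporting `I_x ≅ Ẑ` to the kernel, and Thm. 1.9 (b) in natural form -/

/-- A topological isomorphism `I_x ≅ Ẑ` (the content of "`I_x ≅ Ẑ(1)`" with the Galois action
forgotten) transports along the continuous bijection `I_x → Ker(Δ^{c-cn}_{U_x} ↠ Δ_X)` (a homeomorphism:
`I_x` compact, the kernel Hausdorff) to `Ker ≅ Ẑ`. [cite: MochizukiAbsTopIII2015, Prop 1.4 (ii) p.31] -/
def kerEquivZHatOfInertia (h : IsCuspidallyCentralExtension q I) (hIc : IsClosed (I : Set E.arith))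
    (e₀ : Additive I ≃ₜ+ ZHatCoeff.{u}) :
    Additive (ContinuousCohomology.extKer (deltaCcnProjₜ q)) ≃ₜ+ ZHatCoeff.{u} := by
  haveI : CompactSpace I := isCompact_iff_compactSpace.mp hIc.isCompact
  haveI : CompactSpace (Additive I) := ‹CompactSpace I›
  haveI : IsClosed (cuspidallyCentralModulus q : Set E.arith) := Subgroup.isClosed_topologicalClosure _
  haveI : T2Space (Additive (ContinuousCohomology.extKer (deltaCcnProjₜ q))) :=
    inferInstanceAs (T2Space (ContinuousCohomology.extKer (deltaCcnProjₜ q)))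
  let ι : Additive I ≃+ Additive (ContinuousCohomology.extKer (deltaCcnProjₜ q)) :=
    AddEquiv.ofBijective (MonoidHom.toAdditive (inertiaToExtKer h.le_cuspidalKernel))
      (inertiaToExtKer_bijective h)
  have hcont : Continuous ι :=
    continuous_ofMul.comp ((continuous_inertiaToExtKer h.le_cuspidalKernel).comp continuous_toMul)
  have hsymm : Continuous ι.symm := by
    have h1 : Continuous ι.toEquiv := hcont
    exact h1.continuous_symm_of_equiv_compact_to_t2
  exact
    { (ι.symm.trans e₀.toAddEquiv) with
      continuous_toFun := by
        change Continuous fun y => e₀.toAddEquiv (ι.symm y)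
        exact e₀.continuous.comp hsymm
      continuous_invFun := by
        change Continuous fun z => ι.symm.symm (e₀.toAddEquiv.symm z)
        exact hcont.comp e₀.symm.continuous }

namespace CurveModel

variable (M : CurveModel.{u})

/-- **Thm. 1.9 (b) in natural form is a THEOREM modulo "`I_x ≅ Ẑ`"**: if every cyclotome presentation
of the model has its inertia group topologically isomorphic to `Ẑ` ("`I_x ≅ Ẑ(1)`", Prop. 1.4 (i)),
then `Thm_1_9_b_natural M` holds — the synchronization `I_x → M_X` is bijective for every section and
every bijectivity witness of the differential (and it is `D_x`-equivariant,
`inertiaSynchronization_decomp`).  PROVED. [cite: MochizukiAbsTopIII2015, Thm 1.9 (b) p.37] -/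
theorem thm_1_9_b_natural_of_inertiaEquiv
    (he : ∀ (Ux X : M.Curve) (h : M.IsCofiniteOpen Ux X) (x : (M.cusps Ux).Cusp),
      M.IsCyclotomePresentation h x → Nonempty (Additive ((M.cusps Ux).Icusp x) ≃ₜ+ ZHatCoeff.{u})) :
    M.Thm_1_9_b_natural := by
  intro Ux X h x hp s hd
  obtain ⟨e₀⟩ := he Ux X h x hp
  have hIc := (M.cusps Ux).isClosed_Icusp x
  exact inertiaSynchronization_bijective hp.isCuspidallyCentral s hd
    (kerEquivZHatOfInertia hp.isCuspidallyCentral hIc e₀)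

end CurveModel

end Literature.AnabelianGeometry.AbsoluteAnabelian.AbsTopIII
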